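import Summits.Ventures.Crystal3D.Theorems.StickyWulffConstantCoaxialWallLawReachCoreOfRowsA
import Summits.Ventures.Crystal3D.Theorems.StickyWulffConstantCoaxialWallLawTwoRowsCertified
import HarnessLib

/-!
# The crux `CoaxialWallLaw` from `P5Exhaustion` and the two v2(A) census rows at `s_F = 9/2`, kissing facts CERTIFIED

HONEST FRAMING. Venture `Summits/Ventures/Crystal3D` (cell `crystal3d-full`), helper `--supports` the crux
`CoaxialWallLaw` of `route-Ventures-StickyWulffConstant` (REGISTERED line `WallLedgerF`).  Rung credit; F-C1 not
moved; CONDITIONAL on named facts; grade COMPUTATIONAL (imports the tree's certified `kissingGap_250`,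
`kissingClassification_250`, `StarFar.starPairFar_holds`, exactly as `…TwoRowsCertified`).  cf-p1 g28 (xxxviii″): the
KEY OF RECORD is `(v2(A), r = 1)` with CERTIFICATE CONSTANT `s_F* = 9/2` (DECISION (xliii)); lane F's by-name debts at
that key are E1 (`P5Exhaustion`, cf-p2) and the two rows `EndRowTwinHalfTurnA v2 (9/2)`, `EndRowTransA v2 (9/2)`
(`…EndRowDefsA`).

* `coaxialWallLaw_of_twoRowsA_certified` — any version, any `0 < s_F ≤ 2√6`;
* **`coaxialWallLaw_of_twoRows_v2A_nineHalves`** : `P5Exhaustion → EndRowTwinHalfTurnA v2 (9/2) → EndRowTransA v2 (9/2) →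
  CoaxialWallLaw` — THE LANE-F CAPSTONE AT THE KEY AND CONSTANT OF RECORD.
WHAT THIS IS NOT: the rows (census facts); F-C1 not moved.
-/

noncomputable section

namespace Summit.Ventures.Crystal3D.Theorems

open Summit.Ventures.Crystal3D

/-- **The crux from `P5Exhaustion` and the two (A) census rows at any version, kissing facts certified.** -/
theorem coaxialWallLaw_of_twoRowsA_certified (ver : WordVersion) (hE1 : P5Exhaustion) {sF : ℝ} (hsF : 0 < sF)
    (hsF' : sF ≤ 2 * Real.sqrt 6) (hrowW : EndRowTwinHalfTurnA ver sF) (hrowT : EndRowTransA ver sF) :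
    Summit.Ventures.Crystal3D.Theses.StickyWulffConstant.CoaxialWallLaw :=
  coaxialWallLaw_of_twoRowsA_p5 ver kissingGap_250 kissingClassification_250 hsF hsF' hrowW hrowT hE1
    StarFar.starPairFar_holds

/-- `9/2 ≤ 2√6` (`81/4 ≤ 24`). -/
theorem nine_halves_le_two_sqrt_six : (9 / 2 : ℝ) ≤ 2 * Real.sqrt 6 := by
  have h6 : (0 : ℝ) ≤ Real.sqrt 6 := Real.sqrt_nonneg 6
  have h66 : Real.sqrt 6 * Real.sqrt 6 = 6 := Real.mul_self_sqrt (by norm_num)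
  nlinarith [h6, h66]

/-- **THE LANE-F CAPSTONE AT THE KEY AND CONSTANT OF RECORD `(v2(A), r = 1)`, `s_F* = 9/2`:** the crux from
`P5Exhaustion` and the two (A) census rows at version `v2` with constant `9/2`. -/
theorem coaxialWallLaw_of_twoRows_v2A_nineHalves (hE1 : P5Exhaustion)
    (hrowW : EndRowTwinHalfTurnA WordVersion.v2 (9 / 2)) (hrowT : EndRowTransA WordVersion.v2 (9 / 2)) :
    Summit.Ventures.Crystal3D.Theses.StickyWulffConstant.CoaxialWallLaw :=
  coaxialWallLaw_of_twoRowsA_certified WordVersion.v2 hE1 (by norm_num) nine_halves_le_two_sqrt_six hrowW hrowT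

end Summit.Ventures.Crystal3D.Theorems

end
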